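import Summits.ResolutionOfSingularities.ResolutionOfSingularities.Theorems.LightCutCells
import HarnessLib

/-!
# LightCutMapA — decomp-res node «LightCut» rev 2 §7 MAP (a) (lens-6 g22, critic row 171), §7 file 1/2

Content VERBATIM from the decomp-res lens-6 g22 node `HOME/decomp-res-lens-6/g22/LightCut.lean` rev 2 (pin eb3d2900,
1 426 l = rev 1 `61988fc1` + the pure
insertion §7 `section MapA`, l. 972–1423; farm rc 0 · 0 sorry · axioms std; HOME = run/shared/lean/pub/decomp-res).
Critic: CRITIC-LEDGER row 171 (2026-08-31T02:44:31Z):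
«LightCut» rev 2 CLEARED MAP +1 — MAP (a) of row 166 SETTLED NEGATIVELY: `E1TopHeavy` LEAKS BOTH WAYS (R3 = `z³ +
t²u² + t⁵ + u⁵ + w⁴` over `𝔽₃` is HEAVY with NO near
point; R2's near point is TAME).  Landing orders INBOX :731 (lens-6) / :734 (critic): §7 as a THIRD node file over
the untouched rev-1 files `LightCutLaw` · `LightCutLaw2` ·
`LightCutCells` (p803046 / p803238 / p803837; rev-1 declarations byte-identical in rev 2), namespace
`…Theorems.LightCutClasses`, `--supports
stmt-ResolutionOfSingularities-26971`; NO column edit (row 166's aside `LCE1TopHeavy` stands; `E1TopHeavy` is not a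
root-datum induction class; no new cell, no new aside).
WRITER'S CHOICE (row 171, option 2, stated on the bus): the PROOF-KIND part only — the §7a certificates,
`wildSuccessor_iff_pPowerFormAt`, `X_mul_mem_span_X_pow_iff`; the two
typed record sentences `def NearPointOfHeavyPrincipal : Prop` / `def WildSuccessorOfHeavyPrincipal : Prop`
(settled-NEGATIVE records, refuted by the R3 / R2 certificates here;
NOT cells, NOT asides, NOT wanted) are left OUT of the tree and live in the lens file.  File split only (tree files
≤ 400 lines): `section MapA`, its opens / variables,
`section chart_lemmas` and every declaration exactly as in the lens; the node's global dupNamespace-linter line dropped.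

The lens header's §7 entry, verbatim:

> * §7 (rev 2) MAP (a) of CRITIC-LEDGER row 166 SETTLED NEGATIVELY: the induction forms «`nearPoint_of_heavy_principal`» and
>   «`heavy_transform_iff`» written out as typed sentences `NearPointOfHeavyPrincipal`, `WildSuccessorOfHeavyPrincipal` — BOTH
>   FALSE: R3 = `z³ + t²u² + t⁵ + u⁵ + w⁴` over `𝔽₃` is HEAVY with NO near point (`R3_heavy_and_nearPointFree`: heaviness +
>   `s·f'ᵢ ∉ 𝔫³` in all FOUR charts at every prime over the origin, over every field of characteristic 3), and R2's
near point is
>   TAME (`tame_successor_quartic`); typed re-typing `wildSuccessor_iff_pPowerFormAt` (tree dictionary by name) +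
>   `X_mul_mem_span_X_pow_iff` (graded: `U·H` is a `p`-power form ⟺ `H = λU^{p−1}` — ALL layers, Hironaka's δ, lane (N)).
>   `E1TopHeavy` is not a root-datum induction class; no new cell, no new aside.

## This file

§7 GENERIC ALGEBRA (`derivation_pow_succ_mem`, `derivs_mem_of_mul_mem_cube`, `two_not_mem`) followed by §7b THE
TYPED RE-TYPING (moved ahead of the §7a certificates so that the node lands as two files; contents and `section
MapA` context unchanged): `derivation_pow_succ_mem`, `derivs_mem_of_mul_mem_cube`, `two_not_mem`,
`wildSuccessor_iff_pPowerFormAt`, `X_mul_mem_span_X_pow_iff`.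

[WRITER NOTE (decomp-res writer g10): split at the 400-line cap into `LightCutMapA` (+ continuation files); dedup
watch (row 171): `derivation_pow_succ_mem`,
`derivs_mem_of_mul_mem_cube`, `two_not_mem` are NEW statements (iterated / cube versions — not the landed
`RadicialJung.CleanModels.derivation_apply_mem_of_mem_sq`, which
`LightCutCells` already cites by name); the chart lemmas `d_self` / `d_ne` / `d_two` are `private` as in the lens.]

(Sources: Hironaka 1967 (characteristic polyhedra); CossartJannsenSaito2020 Thm. 9.6 (2) p. 136, Def. 3.13 / Thm.
3.14 p. 129; CossartPiltant2008 §2; Giraud1975; Hironaka1970Additive; Moh1987.)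
-/

noncomputable section

open CategoryTheory AlgebraicGeometry TopologicalSpace IsLocalRing
open Literature.AlgebraicGeometry.Resolution

universe u

namespace Summit.ResolutionOfSingularities.ResolutionOfSingularities.Theorems.LightCutClasses

open Summit.ResolutionOfSingularities.ResolutionOfSingularities.Theorems.TwistCutClasses

section MapA

open MvPolynomial
open Summit.ResolutionOfSingularities.ResolutionOfSingularities.Theorems
open WeakOrderReduction ForcedTowerClasses SubfieldContactClasses AbsoluteContactClasses PurityValveClasses TwistCutClasses

/-! ## §7 MAP (a) of CRITIC-LEDGER row 166 SETTLED NEGATIVELY: `E1TopHeavy` LEAKS BOTH WAYS (rev 2; pure insertion)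

The two induction forms row 166 (a) named are written out below as TYPED SENTENCES — `NearPointOfHeavyPrincipal`
(«`nearPoint_of_heavy_principal`») and `WildSuccessorOfHeavyPrincipal` (the ⇒ half of «`heavy_transform_iff`») — and both are
FALSE, by certified inhabitants of the PRINCIPAL PERFECT core:
* **R3** = `z³ + t²u² + t⁵ + u⁵ + w⁴` over `𝔽₃` (`Y` = the open of `𝔸⁴` where `ord ≤ 3`, `M = ((f), 3)`, `y = 0`):
closed, perfect,
  `in f = z³` (WILD, `HugValuationCut.not_isAbsContactAt_of_pPowerFormAt`), non-split (perfect residue field, `edim 4`: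
  `TwistCutClasses.not_diffSplitAt_of_scalar`), isolated top point (`∂_w f = w³`, Hasse `D_t^{(2)} f = u² + t³`,
`D_u^{(2)} f = t² + u³`,
  `D_tD_u f = tu`), PRINCIPAL, and HEAVY (`heavy_R3`: the layer `t²u² + w⁴` reduces in chart `u` to `T'² + W'⁴ ∈
(Z̄, T', W')²`; the
  multiplicity-2 points `[1:0:0]`, `[0:1:0]` of the quartic `T²U² + W⁴` on `ℙ(Dir_y)` are intrinsic, so the light
condition fails
  in EVERY presentation) — yet `y` HAS NO NEAR POINT: in each of the FOUR Rees charts the controlled transform has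
order `≤ 2 < 3`
  at EVERY prime containing the exceptional parameter, over EVERY field of characteristic 3 (`notNear_R3_chart_u/t/w/z`; method:
  two derivations lower `𝔫³` to `𝔫`, `derivs_mem_of_mul_mem_cube`) — ONE kernel statement `R3_heavy_and_nearPointFree`.  So R3,
  in `E1TopHeavyPrincipal`'s class, is resolved by ONE blow-up: the class leaks DOWNWARDS.
* **R2** = `z³ + t⁴ + u²w²` (§6 `heavy_quartic`) has the near point `𝔫 =` origin of chart `u`, `f' = z'³ + u·w'² + u·t'⁴`, and
  `tame_successor_quartic`: `∂_{w'}² f' = 2u`, i.e. the Hasse derivative `D^{(2)}_{w'} f' = u ∈ 𝔫 ∖ 𝔫²` — an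
absolute operator of order
  `2 = n − 1` extracts a regular parameter: the successor is TAME (`IsAbsContactAt`, AbsoluteContactPrimitives :75)
and LEAVES the
  class: it leaks UPWARDS into the tame engine.
HONEST RE-TYPING (typed, no new cell, no new aside — «heavy but near-point-free» sub-cells are 0): at a near point `y'` over a
principal PERFECT wild point the successor is wild again ⟺ `PPowerFormAt p (transform) n y'`
(`wildSuccessor_iff_pPowerFormAt` = the
tree dictionary `HugValuationCut.isAbsContactAt_iff_not_pPowerFormAt`, PPowerForm.lean :203, BY NAME; closed points
over EVERY field:
`isAbsContactAt_iff_not_pPowerFormAt_closed`, ContactFreeIsPPower.lean :148), and at the graded level `in_𝔫 f' = σā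
Z'^p + U·H` is a
`p`-power form ⟺ `H = λU^{p−1}` (`X_mul_mem_span_X_pow_iff`), where `H = [G₁]_{p−1} + U[G₂]_{p−2} + … +
U^{p−1}[G_p]_0` involves ALL
layers — Hironaka's δ / vertex datum («δ' > 1 ⟺ very near», CossartJannsenSaito2020 LNM 2270 Thm 9.6 (2) p.136; tree
`Literature.…CharPolyhedronDelta` (`delta`, `deltaL`), `CharPolyhedronDeltaPositive` (`deltaGE_one_pos_iff_forall_mem`,
`IsMinimal.exists_pos_deltaGE_iff`), `Hironaka1970NearPoint*`) — i.e. the object of lane (N); `E1TopHeavy` is NOT a root-datum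
induction class. -/

/-- Derivations lower the power of an ideal by one: `D (I^(k+1)) ⊆ I^k`. [folklore] -/
theorem derivation_pow_succ_mem {R A : Type*} [CommSemiring R] [CommRing A] [Algebra R A] (D : Derivation R A A)
    (I : Ideal A) : ∀ (k : ℕ) {x : A}, x ∈ I ^ (k + 1) → D x ∈ I ^ k := by
  intro k
  induction k with
  | zero => intro x _; simp
  | succ k ih =>
    intro x hx
    rw [pow_succ] at hx
    refine Submodule.mul_induction_on hx (fun a ha b hb => ?_) (fun x y hx hy => ?_)
    · rw [Derivation.leibniz, smul_eq_mul, smul_eq_mul]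
      refine Ideal.add_mem _ ?_ ?_
      · exact Ideal.mul_mem_right _ _ ha
      · rw [pow_succ']; exact Ideal.mul_mem_mul hb (ih ha)
    · rw [map_add]; exact Ideal.add_mem _ hx hy

/-- If `s ∉ 𝔫` (prime) and `s·g ∈ 𝔫³` then `g ∈ 𝔫`, `D g ∈ 𝔫` and `D (D' g) ∈ 𝔫` for all derivations `D, D'`.
[elementary] [folklore] -/
theorem derivs_mem_of_mul_mem_cube {R A : Type*} [CommSemiring R] [CommRing A] [Algebra R A]
    (𝔫 : Ideal A) [h𝔫 : 𝔫.IsPrime] {s g : A} (hs : s ∉ 𝔫) (hsg : s * g ∈ 𝔫 ^ 3) (D D' : Derivation R A A) :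
    g ∈ 𝔫 ∧ D g ∈ 𝔫 ∧ D (D' g) ∈ 𝔫 := by
  have h1 : s * g ∈ 𝔫 := Ideal.pow_le_self (by norm_num) hsg
  have hg : g ∈ 𝔫 := (h𝔫.mem_or_mem h1).resolve_left hs
  -- one derivative: `E (s g) ∈ 𝔫²`, hence `s · E g ∈ 𝔫` (as `g ∈ 𝔫`), hence `E g ∈ 𝔫`
  have hD : ∀ E : Derivation R A A, E g ∈ 𝔫 := by
    intro E
    have h2 : E (s * g) ∈ 𝔫 ^ 2 := derivation_pow_succ_mem E 𝔫 2 hsg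
    have h2' : E (s * g) ∈ 𝔫 := Ideal.pow_le_self (by norm_num) h2
    rw [Derivation.leibniz, smul_eq_mul, smul_eq_mul] at h2'
    have : s * E g ∈ 𝔫 := by
      have := Ideal.sub_mem _ h2' (Ideal.mul_mem_left _ (E s) hg)
      rwa [show s * E g + g * E s - E s * g = s * E g by ring] at this
    exact (h𝔫.mem_or_mem this).resolve_left hs
  refine ⟨hg, hD D, ?_⟩
  -- two derivatives: `D (D' (s g)) ∈ 𝔫`; expand by Leibniz twice
  have h3 : D (D' (s * g)) ∈ 𝔫 := by
    have := derivation_pow_succ_mem D 𝔫 1 (derivation_pow_succ_mem D' 𝔫 2 hsg)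
    rwa [pow_one] at this
  rw [Derivation.leibniz, smul_eq_mul, smul_eq_mul, map_add, Derivation.leibniz, Derivation.leibniz, smul_eq_mul,
    smul_eq_mul, smul_eq_mul, smul_eq_mul] at h3
  -- h3 : s * D (D' g) + D' g * D s + (g * D (D' s) + D' s * D g) ∈ 𝔫
  have : s * D (D' g) ∈ 𝔫 := by
    have hrest : D' g * D s + (g * D (D' s) + D' s * D g) ∈ 𝔫 :=
      Ideal.add_mem _ (Ideal.mul_mem_right _ _ (hD D')) (Ideal.add_mem _ (Ideal.mul_mem_right _ _ hg)
        (Ideal.mul_mem_left _ _ (hD D)))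
    have := Ideal.sub_mem _ h3 hrest
    rwa [show s * D (D' g) + D' g * D s + (g * D (D' s) + D' s * D g) - (D' g * D s + (g * D (D' s) + D' s * D g))
      = s * D (D' g) by ring] at this
  exact (h𝔫.mem_or_mem this).resolve_left hs

variable {K : Type*} [Field K]

/-- In characteristic `3`, `2` lies in no prime ideal of a polynomial ring. [folklore] -/
theorem two_not_mem [CharP K 3] {σ : Type*} (𝔫 : Ideal (MvPolynomial σ K)) [h𝔫 : 𝔫.IsPrime] :
    (2 : MvPolynomial σ K) ∉ 𝔫 := by
  intro h
  have h2 : (2 : K) ≠ 0 := by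
    intro h0
    have : (3 : ℕ) ∣ 2 := (CharP.cast_eq_zero_iff K 3 2).1 (by exact_mod_cast h0)
    omega
  have hu : IsUnit (2 : MvPolynomial σ K) := by
    have := h2.isUnit.map (C : K →+* MvPolynomial σ K)
    rwa [map_ofNat] at this
  exact h𝔫.ne_top (Ideal.eq_top_of_isUnit_mem _ h hu)

/-! ### §7b The typed re-typing (the two typed record sentences of row 166 (a), `NearPointOfHeavyPrincipal` /
`WildSuccessorOfHeavyPrincipal` —
both FALSE by §7a — stay in the lens file (HOME/decomp-res-lens-6/g22/LightCut.lean rev 2 l. 1321–1353) and are NOT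
tree declarations: critic row 171 option 2) -/

/-- **THE TYPED RE-TYPING (scheme level) — successor WILD ⟺ `p`-POWER FORM**: on a base of the class over a PERFECT field (the
principal perfect core; the blow-up of a base is a base, `TwistCutClasses.baseStable_holds`), at every point `y'` of
order exactly `n ≥ 1`
of an ideal `𝓘'` (e.g. the transform at a near point), `¬ IsAbsContactAt 𝓘' n y' ⟺ PPowerFormAt p 𝓘' n y'` — the tree dictionary
`HugValuationCut.isAbsContactAt_iff_not_pPowerFormAt` (PPowerForm.lean :203) BY NAME; for closed points over EVERY field:
`HugValuationCut.isAbsContactAt_iff_not_pPowerFormAt_closed` (ContactFreeIsPPower.lean :148).  [tree; restated] [folklore] -/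
theorem wildSuccessor_iff_pPowerFormAt {p : ℕ} (hp : p.Prime) {k : Type} [Field k] [CharP k p] [PerfectField k]
    {Y' : Scheme.{0}} (g' : Y' ⟶ Spec (.of k)) (hB' : IsBase Y' g') (I' : Y'.IdealSheafData) {n : ℕ} {y' : Y'}
    (hn : 0 < n) (hord : idealOrder I' y' = ((n : ℕ) : ℕ∞)) :
    ¬ IsAbsContactAt I' n y' ↔ HugValuationCut.PPowerFormAt p I' n y' := by
  rw [HugValuationCut.isAbsContactAt_iff_not_pPowerFormAt hp g' hB' I' hn hord, not_not]

/-- **Graded dictionary «successor wild ⟺ λU^{p-1}»** (polynomial level): for any `H`, `U · H` is a `p`-power form of degree `p`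
— a `K`-combination of `p`-th powers of the variables — iff `H = λ · U^{p-1}`.  Applied to `in_𝔫 f' = σā Z'^p + U ·
in_{p-1}(G₁ + UG₂ + …)`
at a near point `𝔫` over a principal perfect wild point (`PPowerFormAt` ⟺ wild: tree `isAbsContactAt_iff_not_pPowerFormAt`,
PPowerForm :203; closed points of `FGGround` schemes: ContactFreeIsPPower :148): the successor is wild again iff
`[G₁]_{p-1} + U[G₂]_{p-2} + … + U^{p-1}[G_p]_0 = λU^{p-1}` — ALL layers (Hironaka's δ / vertex datum, «δ' > 1 ⟺ very near»,
CJS LNM 2270 Thm 9.6 (2) p.136; tree `CharPolyhedronDelta`, `CharPolyhedronDeltaPositive`,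
`Hironaka1970NearPoint*`).  [new; elementary] [folklore] -/
theorem X_mul_mem_span_X_pow_iff {σ : Type*} [DecidableEq σ] (p : ℕ) (hp : 1 ≤ p) (i : σ) (H : MvPolynomial σ K) :
    X i * H ∈ Submodule.span K (Set.range fun j : σ => (X j : MvPolynomial σ K) ^ p) ↔
      ∃ c : K, H = C c * X i ^ (p - 1) := by
  classical
  constructor
  · intro hmem
    obtain ⟨l, hl⟩ := (Finsupp.mem_span_range_iff_exists_finsupp).1 hmem
    -- every monomial of `H` is `single i (p-1)`
    have hsupp : ∀ m ∈ H.support, m = Finsupp.single i (p - 1) := by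
      intro m hm
      have hcoef : coeff (m + Finsupp.single i 1) (X i * H) ≠ 0 := by
        rw [show (X i : MvPolynomial σ K) * H = H * X i from mul_comm _ _, coeff_mul_X]
        exact mem_support_iff.1 hm
      rw [← hl] at hcoef
      -- the coefficient of `m + single i 1` in `Σ l_j X_j^p`
      have hsum : coeff (m + Finsupp.single i 1) (l.sum fun j a => a • (X j : MvPolynomial σ K) ^ p)
          = l.sum fun j a => if Finsupp.single j p = m + Finsupp.single i 1 then a else 0 := by
        rw [Finsupp.sum, Finsupp.sum, coeff_sum]
        refine Finset.sum_congr rfl fun j _ => ?_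
        rw [coeff_smul, X_pow_eq_monomial, coeff_monomial, smul_eq_mul, mul_ite, mul_one, mul_zero]
      rw [hsum] at hcoef
      obtain ⟨j, -, hj⟩ := Finset.exists_ne_zero_of_sum_ne_zero hcoef
      have hj' : Finsupp.single j p = m + Finsupp.single i 1 := by
        by_contra h; exact hj (if_neg h)
      have hji : j = i := by
        by_contra hne
        have := Finsupp.ext_iff.1 hj' i
        have h0 : (Finsupp.single j p) i = 0 := by simp [hne]
        have h1 : (m + Finsupp.single i 1 : σ →₀ ℕ) i = m i + 1 := by simp
        omega
      subst hji
      ext k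
      have hk := Finsupp.ext_iff.1 hj' k
      by_cases hkj : j = k
      · subst hkj
        have e1 : (Finsupp.single j p) j = p := by simp
        have e2 : (m + Finsupp.single j 1 : σ →₀ ℕ) j = m j + 1 := by simp
        have e3 : (Finsupp.single j (p - 1)) j = p - 1 := by simp
        omega
      · have e1 : (Finsupp.single j p) k = 0 := by simp [hkj]
        have e2 : (m + Finsupp.single j 1 : σ →₀ ℕ) k = m k := by simp [hkj]
        have e3 : (Finsupp.single j (p - 1)) k = 0 := by simp [hkj]
        omega
    refine ⟨coeff (Finsupp.single i (p - 1)) H, ?_⟩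
    rw [C_mul_X_pow_eq_monomial]
    ext m
    rw [coeff_monomial]
    split_ifs with h
    · rw [h]
    · exact notMem_support_iff.1 fun hm => h (hsupp m hm).symm
  · rintro ⟨c, rfl⟩
    have : X i * (C c * X i ^ (p - 1)) = c • ((X i : MvPolynomial σ K) ^ p) := by
      rw [smul_eq_C_mul, ← mul_assoc, mul_comm (X i), mul_assoc, ← pow_succ', Nat.sub_add_cancel hp]
    rw [this]
    exact Submodule.smul_mem _ c (Submodule.subset_span ⟨i, rfl⟩)

end MapA

end Summit.ResolutionOfSingularities.ResolutionOfSingularities.Theorems.LightCutClasses
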